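import Literature.AlgebraicTopology.SingularHomology.LoopClassesSpan
import HarnessLib

/-!
# Point classes in `H₀` and the counting functional of a clopen set

A. Hatcher, *Algebraic Topology* (2002), §2.1, Prop. 2.6–2.7 (pp. 109–110): `H₀(X)` splits over
the path components, each summand detected by the augmentation `ε (∑ nᵢ σᵢ) = ∑ nᵢ`; a singular
simplex has path-connected (in particular connected) image, so for a CLOPEN subset `C ⊆ X` the
partial augmentation "sum of the coefficients of the `0`-simplices lying in `C`" still kills
boundaries (both end points of a `1`-simplex lie in `C` or both lie outside) and descends to
`H₀(X; R)`.  For Mathlib's singular homology `Literature.singularHomology R R X 0`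
(`SingularChains.lean`) this file provides:

* `pointClass r x = [r · x] ∈ H₀(X; R)`, the class of the `0`-simplex at `x` with coefficient `r`;
  `pointClass_eq_of_joined` (joined points have the same class: `∂(r γ) = r[y] − r[x]`),
  `map_pointClass` (naturality);
* `clopenCount C : C₀(X; R) → R`, `∑ rᵢ ρᵢ ↦ ∑_{ρᵢ ∈ C} rᵢ`, with `clopenCount C ∘ ∂ = 0` for clopen
  `C` (`clopenCount_comp_d`), and its descent **`clopenCountH hC : H₀(X; R) →ₗ[R] R`** with
  **`clopenCountH_pointClass : clopenCountH hC (pointClass r x) = r · 𝟙_C(x)`**.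

These are the functionals through which the Mayer–Vietoris connecting map
`∂ : H₁(U ∪ V) → H₀(U ∩ V)` is read on explicit loops (Hatcher §2.2 p. 150, `∂[z_U + z_V] = [∂z_U]`,
a signed count of crossing points per component of `U ∩ V`); first client: the homology shadow of
the Lefschetz base (`Literature/Topology/FourManifolds/LefschetzBasePages.lean`, `IsChainShadow`).
Everything is proved; no named facts.

## References
* A. Hatcher, *Algebraic Topology*, CUP 2002, §2.1 Prop. 2.6, Prop. 2.7; §2.2 p. 150. [HatcherAT2002]
-/

noncomputable section

-- as in `LoopClassesSpan.lean`: Mathlib's singular chains agree with the concrete `Finsupp` chains up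
-- to unfolding
set_option backward.isDefEq.respectTransparency false

open CategoryTheory Set

universe u v

namespace Literature.AlgebraicTopology.SingularHomology

open SingularSimplex singularChainComplex HurewiczProof

variable {R : Type v} [CommRing R] {X Y : Type u} [TopologicalSpace X] [TopologicalSpace Y]

/-! ### Point classes in `H₀` -/

/-- In degree `0` every chain is a cycle. [folklore] -/
lemma d_zero_apply_eq_zero (c : (singularChainComplex R R X).X 0) :
    (singularChainComplex R R X).d 0 ((ComplexShape.down ℕ).next 0) c = 0 := by
  rw [(singularChainComplex R R X).shape 0 _ (by rw [ChainComplex.next_nat_zero]; simp)]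
  rfl

variable (R) in
/-- **The class `[r · x] ∈ H₀(X; R)` of the point `x` with coefficient `r`** (Hatcher 2002, Prop. 2.7:
these classes generate `H₀`). [cite: HatcherAT2002, Prop. 2.7] -/
def pointClass (r : R) (x : X) : singularHomology R R X 0 :=
  homologyCls (single (R := R) (ofPoint x) r) (d_zero_apply_eq_zero _)

/-- **Joined points have the same class**: `∂ (r γ) = r [y] − r [x]` for a path `γ` from `x` to `y`
(Hatcher 2002, proof of Prop. 2.7). [cite: HatcherAT2002, Prop. 2.7] -/
theorem pointClass_eq_of_joined (r : R) {x y : X} (h : Joined x y) : pointClass R r x = pointClass R r y := by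
  obtain ⟨γ⟩ := h
  symm
  rw [pointClass, pointClass, homologyCls_eq_homologyCls_iff,
    exists_d_prev_eq_iff (i := 1) (ChainComplex.prev ℕ 0)]
  exact ⟨single (R := R) (ofPath γ) r, d_single_ofPath R R r γ⟩

/-- The `0`-simplex at `x` is mapped by `f` to the `0`-simplex at `f x`. [folklore] -/
lemma ofPoint_map (f : C(X, Y)) (x : X) : (ofPoint x).map f = ofPoint (f x) := by
  apply toContinuousMap_injective
  ext s : 1
  rw [toContinuousMap_map, ContinuousMap.comp_apply, ofPoint, ofPoint, Equiv.apply_symm_apply,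
    Equiv.apply_symm_apply]
  rfl

/-- **Naturality of point classes**: `f_* [r · x] = [r · f x]`. [folklore] -/
theorem map_pointClass (f : C(X, Y)) (r : R) (x : X) :
    singularHomology.map R R f 0 (pointClass R r x) = pointClass R r (f x) := by
  rw [pointClass, pointClass, singularHomology.map, homologyMap_homologyCls]
  exact homologyCls_congr (by rw [map_f_single, ofPoint_map]) _ _

/-! ### The counting functional of a clopen set -/

variable (R) in
/-- **The partial augmentation of a subset `C`** on `0`-chains: `∑ rᵢ ρᵢ ↦ ∑_{ρᵢ ∈ C} rᵢ`.
[cite: HatcherAT2002, Prop. 2.7] -/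
def clopenCount (C : Set X) : ((singularChainComplex R R X).X 0) →ₗ[R] R :=
  extendSingleₗ fun ρ : SingularSimplex X 0 => C.indicator (fun _ => (1 : R)) ρ.pt

/-- `clopenCount C (r ρ) = r · 𝟙_C(ρ)`. [folklore] -/
@[simp] lemma clopenCount_single (C : Set X) (ρ : SingularSimplex X 0) (r : R) :
    clopenCount R C (single (R := R) ρ r) = r * C.indicator (fun _ => (1 : R)) ρ.pt := by
  rw [clopenCount, extendSingleₗ_single, smul_eq_mul]

/-- The end points of a singular `1`-simplex lie in its (preconnected) image. [folklore] -/
lemma src_mem_range (τ : SingularSimplex X 1) : src τ ∈ τ.range := ⟨_, rfl⟩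

/-- The end points of a singular `1`-simplex lie in its (preconnected) image. [folklore] -/
lemma tgt_mem_range (τ : SingularSimplex X 1) : tgt τ ∈ τ.range := ⟨_, rfl⟩

/-- For a clopen `C`, both end points of a singular `1`-simplex lie in `C` or both lie outside
(its image is preconnected). [folklore] -/
lemma tgt_mem_iff_src_mem {C : Set X} (hC : IsClopen C) (τ : SingularSimplex X 1) : tgt τ ∈ C ↔ src τ ∈ C := by
  have hconn : IsPreconnected τ.range := isPreconnected_range (toContinuousMap τ).continuous
  constructor
  · exact fun h => hconn.subset_isClopen hC ⟨_, tgt_mem_range τ, h⟩ (src_mem_range τ)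
  · exact fun h => hconn.subset_isClopen hC ⟨_, src_mem_range τ, h⟩ (tgt_mem_range τ)

/-- **`clopenCount C ∘ ∂ = 0` for clopen `C`** (Hatcher 2002, Prop. 2.6/2.7: a singular simplex has
connected image). [cite: HatcherAT2002, Prop. 2.6] -/
theorem clopenCount_comp_d {C : Set X} (hC : IsClopen C) :
    clopenCount R C ∘ₗ ((singularChainComplex R R X).d 1 0).hom = 0 := by
  refine linearMap_ext_single fun τ r => ?_
  rw [LinearMap.zero_apply, LinearMap.comp_apply]
  change clopenCount R C ((singularChainComplex R R X).d 1 0 (single (R := R) τ r)) = 0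
  rw [d_single_one', map_sub, clopenCount_single, clopenCount_single, pt_ofPoint, pt_ofPoint]
  by_cases h : src τ ∈ C
  · rw [indicator_of_mem h, indicator_of_mem ((tgt_mem_iff_src_mem hC τ).2 h), sub_self]
  · rw [indicator_of_notMem h, indicator_of_notMem (fun h' => h ((tgt_mem_iff_src_mem hC τ).1 h')), sub_self]

variable (R) in
/-- **The counting functional `H₀(X; R) → R` of a clopen set `C`**: the descent of `clopenCount C`
(Hatcher 2002, Prop. 2.6/2.7: the `C`-summand of the augmentation). [cite: HatcherAT2002, Prop. 2.7] -/
def clopenCountH {C : Set X} (hC : IsClopen C) : singularHomology R R X 0 →ₗ[R] R :=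
  homologyDesc' 1 (ChainComplex.prev ℕ 0) (clopenCount R C) (clopenCount_comp_d hC)

/-- `clopenCountH [z] = clopenCount z` on a `0`-cycle. [folklore] -/
@[simp] lemma clopenCountH_homologyCls {C : Set X} (hC : IsClopen C) (z : (singularChainComplex R R X).X 0)
    (hz : (singularChainComplex R R X).d 0 ((ComplexShape.down ℕ).next 0) z = 0) :
    clopenCountH R hC (homologyCls z hz) = clopenCount R C z := by
  rw [clopenCountH, homologyDesc'_cls]

/-- **The counting functional on a point class: `θ_C [r · x] = r · 𝟙_C(x)`.** [cite: HatcherAT2002, Prop. 2.7] -/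
theorem clopenCountH_pointClass {C : Set X} (hC : IsClopen C) (r : R) (x : X) :
    clopenCountH R hC (pointClass R r x) = r * C.indicator (fun _ => (1 : R)) x := by
  rw [pointClass, clopenCountH_homologyCls, clopenCount_single, pt_ofPoint]

/-- On a point of `C` the counting functional of `[r · x]` is `r`. [folklore] -/
theorem clopenCountH_pointClass_of_mem {C : Set X} (hC : IsClopen C) (r : R) {x : X} (hx : x ∈ C) :
    clopenCountH R hC (pointClass R r x) = r := by
  rw [clopenCountH_pointClass, indicator_of_mem hx, mul_one]

/-- Off `C` the counting functional of `[r · x]` vanishes. [folklore] -/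
theorem clopenCountH_pointClass_of_notMem {C : Set X} (hC : IsClopen C) (r : R) {x : X} (hx : x ∉ C) :
    clopenCountH R hC (pointClass R r x) = 0 := by
  rw [clopenCountH_pointClass, indicator_of_notMem hx, mul_zero]

/-- The counting functional of the whole space is the augmentation: `θ_X [r · x] = r`. [folklore] -/
theorem clopenCountH_univ_pointClass (r : R) (x : X) :
    clopenCountH R (isClopen_univ (X := X)) (pointClass R r x) = r :=
  clopenCountH_pointClass_of_mem _ r (mem_univ x)

end Literature.AlgebraicTopology.SingularHomology
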